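import Summits.ABC.IUTFork.Thm311PartIILattice
import HarnessLib

/-!
# [IUTchIII] Theorem 3.11 over real definitions — the ARCHIMEDEAN integral-structure binder `archPk` and the
# residual hypothesis `harch` of the typed (ii): SETTLED (it forces the trivial integral structure)

Proof-only file (D-0012) of the abc-iut cell (WAVE-4 D-0067 cone-interior discharge prover, seat abc-iut-w4-d001,
gen 2; home layer L6); TAKES NO SIDE on [IUTchIII] Cor. 3.12. Nothing of another seat's file is restated or edited.

CONTEXT. abc-iut-c312-5's `Situation.ofShells` / `LatticeSituation.ofShells` (`Thm311Real2`, `Thm311Real3`)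
instantiate the data (a) of [IUTchIII] Thm. 3.11 (i) over a log-shell signature `L`: at NONARCHIMEDEAN `v_ℚ` the
integral structure `I(^{S^±_{j+1}};D⊢_{v_ℚ})` is `L.shellPk j v_ℚ` = the additive subgroup of the tensor packet
generated by the pure tensors of elements of the subgroups `L.shellSubgroup v` generated by the shells `I_v`
([IUTchIII] Prop. 3.2 (ii) p. 98 "by forming suitable direct sums and tensor products"); at ARCHIMEDEAN `v_ℚ` it is a
BINDER `archPk j v_ℚ` (print, Prop. 3.2 (ii) p. 98 l. −4 – p. 99 l. 5: "by regarding the mono-analytic log-shell …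
as the “closed unit ball” of a Hermitian metric … together with the induced tensor product Hermitian metric on
`log(^A𝒟⊢_{v_ℚ})`, one obtains Hermitian metrics … whose associated closed unit balls `𝓘(^A𝒟⊢_{v_ℚ}) ⊆ log(^A𝒟⊢_{v_ℚ})`
… may be regarded as integral structures" — tree: abc-iut-w4-d039 `Literature.IUT.LogThetaLattice.hermitianBallN`).
abc-iut-w4-d087's discharge of the typed Thm. 3.11 (ii) at the real carriers (`Thm311PartIILattice`,
`Real.partII_ofShells_honestImages`, p413299) and abc-iut-c312-1's real-instantiation assembly of the whole typed
Thm. 3.11 (`Thm311RealFull`, `Real.full_statement_iff_degreeClause`, p414519) carry the ARCHIMEDEAN residual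
hypothesis `harch : ∀ j v_ℚ, ¬IsNon v_ℚ → (L.shellPk j v_ℚ : Set _) ⊆ archPk j v_ℚ`.

WHAT THIS FILE PROVES (classical; [IUTchIII] Rmk. 1.2.2 (ii) p. 36: at an archimedean `v` the log-shell is
`I_v = {a ∈ K_v | |a| ≤ π}` — abc-iut-c312-5's `Real.shell_inl`):
* `Real.completion_addSubgroup_closure_normBall_eq_top` — in the archimedean completion `K_w` the closed ball of radius `π`
  GENERATES `K_w` as an additive group (`a = (n+1)·(a/(n+1))`), hence `Real.shellSubgroup_inl_eq_top`;
* `LogShells.shellPk_eq_top_of_shellSubgroup_eq_top` — for ANY signature, if every `shellSubgroup v`, `v | v_ℚ`, is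
  everything, then `shellPk j v_ℚ = ⊤` (every `r • ⊗ x_i` is a pure tensor: absorb `r` into the factor `0`); so
  **`Real.shellPk_inl_eq_top`**: over abc-iut-c312-5's real signature `Real.logShells X logv Aut Ism …` the
  pure-tensor subgroup at `v_ℚ = ∞` is the WHOLE PACKET, for every logarithm binder `logv` and every `Aut`, `Ism`;
* **`Real.harch_iff_archPk_eq_univ`** — consequently the residual `harch` HOLDS IFF `archPk j ∞ = univ` for every
  label `j`: it is dischargeable, but ONLY by the trivial archimedean integral structure; in particular the
  archimedean integral structure of w4-d087's hypothesis-free `Real.partII_ofShells_defined` (which takes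
  `archPk := L.shellPk`) IS the whole packet (`Real.coe_shellPk_inl_eq_univ`), and NO proper subset — a fortiori not
  print's closed unit ball of the tensor-product Hermitian metric — can be substituted (`Real.not_harch_of_ne_univ`);
* `Real.partII_ofShells_archPk_univ` — the typed (ii) at the real instantiation with `archPk := univ` and the
  analytic logarithms, no hypothesis (= `partII_ofShells_defined` with the trivialisation made explicit).

READING NOTE (typed vs print; recorded, not adjudicated). The typed (ii)/(Ind3) route
(`Column.ind3_logShells_of_honestImages`) asks the (a)-integral structure at EVERY `v_ℚ` to contain `L.shellPk`.
Print's (Ind3) at `v_ℚ ∈ 𝕍^arc_ℚ` ([IUTchIII] Prop. 3.5 (ii)(b) p. 105) asks the Hermitian unit ball to contain "the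
image, via the tensor product, over `|t|`, … of both (1) the groups of units `(Ψ_cns(^{n,m}𝔉_≻)_{|t|})^×_v`, for
`𝕍 ∋ v | v_ℚ`" and "(2) the closed balls of radius `π`" — tensor products of SINGLE-PLACE vectors, which the
Hermitian ball does contain (abc-iut-w4-d001 `Literature.IUT.LogThetaLattice.prop35ii_b_archHermitian`, p413763)
— not the additive subgroup they generate. So at archimedean `v_ℚ` the typed inclusion is STRONGER THAN PRINT, and
the only instantiation satisfying it trivialises `𝓘(^A𝒟⊢_{v_ℚ})`. Which reading the cell's real setting should carry is
the typers' (c312-5 / w4-d087 / c312-1) and the referees' call; this file supplies the kernel facts.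
[claim: Mochizuki2012, status: disputed] for every quotation; everything proved is elementary.
Deliberately NOT here: the Hermitian ball on the real archimedean packet (needs the comparison
`⨂_ℚ ⊕_w K_w → ⨂_ℝ ⊕ ℂ`), log-volumes, any judgement. typed ≠ proved; instantiated ≠ endorsed.
-/

noncomputable section

namespace Summit.ABC.IUTFork.Thm311

open NumberField

variable {T : ThetaIndex}

namespace LogShells

variable (L : LogShells T)

/-- **If every shell subgroup over `v_ℚ` is everything, the pure-tensor subgroup `shellPk j v_ℚ` is the whole
`(j+1)`-tensor packet**: every element of `⨂_ℚ` is a sum of `r • ⊗_i x_i`, and `r • ⊗_i x_i = ⊗_i x'_i` with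
`x'_0 := r • x_0`. [folklore] -/
theorem shellPk_eq_top_of_shellSubgroup_eq_top (j : T.Label) (vQ : T.VQ)
    (h : ∀ v : T.Fibre vQ, L.shellSubgroup v.1 = ⊤) : L.shellPk j vQ = ⊤ := by
  rw [eq_top_iff]
  rintro t -
  induction t using PiTensorProduct.induction_on with
  | smul_tprod r x =>
    have hx : r • PiTensorProduct.tprod ℚ x =
        PiTensorProduct.tprod ℚ (Function.update x 0 (r • x 0)) := by
      rw [MultilinearMap.map_update_smul, Function.update_eq_self]
    rw [hx]
    exact AddSubgroup.subset_closure
      ⟨Function.update x 0 (r • x 0), fun i v => by rw [h v]; exact AddSubgroup.mem_top _, rfl⟩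
  | add x y hx hy => exact AddSubgroup.add_mem _ hx hy

/-- When `shellPk j v_ℚ = ⊤`, a set contains it iff the set is everything. [folklore] -/
theorem shellPk_subset_iff_eq_univ {j : T.Label} {vQ : T.VQ} (h : L.shellPk j vQ = ⊤)
    (S : Set (L.Packet j vQ)) : (L.shellPk j vQ : Set (L.Packet j vQ)) ⊆ S ↔ S = Set.univ := by
  rw [h, AddSubgroup.coe_top, Set.univ_subset_iff]

end LogShells

namespace Real

variable {F : Type} [Field F] [NumberField F]

omit [NumberField F] in
/-- **The closed ball of radius `π` generates the archimedean completion `K_w` as an additive group**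
(`K_w ≅ ℝ` or `ℂ` through the isometry `extensionEmbedding`; `a = (n+1)·(a/(n+1))` with `|a/(n+1)| ≤ π`).
[folklore] -/
theorem completion_addSubgroup_closure_normBall_eq_top (w : InfinitePlace F) :
    AddSubgroup.closure {a : w.Completion | ‖a‖ ≤ Real.pi} = ⊤ := by
  rw [eq_top_iff]
  rintro a -
  obtain ⟨n, hn⟩ := exists_nat_ge (‖a‖ / Real.pi)
  set c : w.Completion := ((n + 1 : ℕ) : w.Completion) with hc_def
  have hc_norm : ‖c‖ = ((n + 1 : ℕ) : ℝ) := by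
    rw [← (InfinitePlace.Completion.isometry_extensionEmbedding w).norm_map_of_map_zero (map_zero _) c, hc_def,
      map_natCast, Complex.norm_natCast]
  have hc_pos : (0 : ℝ) < ‖c‖ := by rw [hc_norm]; positivity
  have hc : c ≠ 0 := norm_pos_iff.mp hc_pos
  have hmem : a / c ∈ AddSubgroup.closure {a : w.Completion | ‖a‖ ≤ Real.pi} := by
    refine AddSubgroup.subset_closure ?_
    show ‖a / c‖ ≤ Real.pi
    rw [norm_div, div_le_iff₀ hc_pos, hc_norm]
    have h1 : ‖a‖ ≤ (n : ℝ) * Real.pi := by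
      have := (div_le_iff₀ Real.pi_pos).mp hn
      linarith
    have h2 : (n : ℝ) * Real.pi ≤ Real.pi * ((n + 1 : ℕ) : ℝ) := by
      rw [Nat.cast_succ]
      nlinarith [Real.pi_pos]
    exact h1.trans h2
  have heq : (n + 1) • (a / c) = a := by
    rw [nsmul_eq_mul, ← hc_def]
    field_simp
  rw [← heq]
  exact AddSubgroup.nsmul_mem _ hmem _

/-- The same for abc-iut-c312-5's carrier `Real.Carrier (inl w)` (which IS `w.Completion`, with its norm).
[folklore] -/
theorem addSubgroup_closure_normBall_inl_eq_top (w : InfinitePlace F) :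
    AddSubgroup.closure {a : Carrier (.inl w : Place F) | ‖a‖ ≤ Real.pi} = ⊤ :=
  completion_addSubgroup_closure_normBall_eq_top w

variable (X : Literature.IUT.LogVolume.PilotData F) (logv : PadicLogs F)
  (Aut Ism : ∀ x : Place F, Set (Carrier x ≃ₗ[ℚ] Carrier x))
  (hAut : ∀ x, LinearEquiv.refl ℚ (Carrier x) ∈ Aut x) (hIsm : ∀ x, LinearEquiv.refl ℚ (Carrier x) ∈ Ism x)

/-- **At an archimedean place the shell subgroup is everything**: `⟨I_w⟩ = K_w` for abc-iut-c312-5's real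
signature, whatever the logarithm binder and the automorphism binders ([IUTchIII] Rmk. 1.2.2 (ii) p. 36:
`I_w = {a ∈ K_w | |a| ≤ π}`). [claim: Mochizuki2012, status: disputed] -/
theorem shellSubgroup_inl_eq_top (w : InfinitePlace F) :
    (logShells X logv Aut Ism hAut hIsm).shellSubgroup (.inl w) = ⊤ := by
  show AddSubgroup.closure (shell logv (.inl w)) = ⊤
  rw [shell_inl]
  exact addSubgroup_closure_normBall_inl_eq_top w

/-- Every place of the fibre over `∞ ∈ V_ℚ` is archimedean, so its shell subgroup is everything. [folklore] -/
theorem shellSubgroup_eq_top_of_fibre_inl (v : (thetaIndex X).Fibre (.inl ())) :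
    (logShells X logv Aut Ism hAut hIsm).shellSubgroup v.1 = ⊤ := by
  obtain ⟨x, hx⟩ := v
  rcases x with w | u
  · exact shellSubgroup_inl_eq_top X logv Aut Ism hAut hIsm w
  · exact absurd hx (by simp [thetaIndex])

/-- **`shellPk j ∞ = ⊤`**: over the real carriers the pure-tensor subgroup of the `(j+1)`-tensor packet at
`v_ℚ = ∞` is the WHOLE PACKET `⨂_{i ≤ j} ⊕_{w | ∞} K_w`, for every label `j`. [claim: Mochizuki2012, status: disputed] -/
theorem shellPk_inl_eq_top (j : (thetaIndex X).Label) :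
    (logShells X logv Aut Ism hAut hIsm).shellPk j (.inl ()) = ⊤ :=
  (logShells X logv Aut Ism hAut hIsm).shellPk_eq_top_of_shellSubgroup_eq_top j _
    (shellSubgroup_eq_top_of_fibre_inl X logv Aut Ism hAut hIsm)

/-- The same at any `v_ℚ ∉ V^non_ℚ` (the only such `v_ℚ` is `∞`). [folklore] -/
theorem shellPk_eq_top_of_not_isNon {vQ : (thetaIndex X).VQ} (hv : ¬ (thetaIndex X).IsNon vQ)
    (j : (thetaIndex X).Label) : (logShells X logv Aut Ism hAut hIsm).shellPk j vQ = ⊤ := by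
  rcases vQ with u | p
  · obtain ⟨⟩ := u
    exact shellPk_inl_eq_top X logv Aut Ism hAut hIsm j
  · exact absurd (RatPlace.isNon_inr p) hv

/-- **The archimedean integral structure of abc-iut-w4-d087's hypothesis-free `Real.partII_ofShells_defined`
(`archPk := L.shellPk`) is the whole packet.** [claim: Mochizuki2012, status: disputed] -/
theorem coe_shellPk_inl_eq_univ (j : (thetaIndex X).Label) :
    ((logShells X logv Aut Ism hAut hIsm).shellPk j (.inl ()) :
      Set ((logShells X logv Aut Ism hAut hIsm).Packet j (.inl ()))) = Set.univ := by
  rw [shellPk_inl_eq_top X logv Aut Ism hAut hIsm j, AddSubgroup.coe_top]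

variable (archPk : ∀ (j : (thetaIndex X).Label) (vQ : (thetaIndex X).VQ),
    Set ((logShells X logv Aut Ism hAut hIsm).Packet j vQ))

/-- **THE ARCHIMEDEAN RESIDUAL `harch` SETTLED**: the hypothesis `harch` of `Real.partII_ofShells_honestImages`
(p413299) / `Real.full_statement_iff_degreeClause` (p414519) holds IFF the archimedean integral-structure binder is
TRIVIAL, `archPk j ∞ = univ` for every label `j`. [claim: Mochizuki2012, status: disputed] -/
theorem harch_iff_archPk_eq_univ :
    (∀ (j : (thetaIndex X).Label) (vQ : (thetaIndex X).VQ), ¬ (thetaIndex X).IsNon vQ →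
        ((logShells X logv Aut Ism hAut hIsm).shellPk j vQ :
          Set ((logShells X logv Aut Ism hAut hIsm).Packet j vQ)) ⊆ archPk j vQ) ↔
      ∀ j : (thetaIndex X).Label, archPk j (.inl ()) = Set.univ := by
  constructor
  · intro h j
    have h' := h j (.inl ()) (by simp [thetaIndex, RatPlace.IsNon])
    rwa [(logShells X logv Aut Ism hAut hIsm).shellPk_subset_iff_eq_univ
      (shellPk_inl_eq_top X logv Aut Ism hAut hIsm j)] at h'
  · intro h j vQ hv
    rcases vQ with u | p
    · obtain ⟨⟩ := u
      rw [h j]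
      exact Set.subset_univ _
    · exact absurd (RatPlace.isNon_inr p) hv

/-- **No proper archimedean integral structure can be substituted**: if `archPk j ∞ ≠ univ` for one label (e.g.
any bounded set, in particular a closed unit ball of a Hermitian metric on the real packet), `harch` FAILS.
[claim: Mochizuki2012, status: disputed] -/
theorem not_harch_of_ne_univ {j : (thetaIndex X).Label} (hj : archPk j (.inl ()) ≠ Set.univ) :
    ¬ ∀ (j : (thetaIndex X).Label) (vQ : (thetaIndex X).VQ), ¬ (thetaIndex X).IsNon vQ →
        ((logShells X logv Aut Ism hAut hIsm).shellPk j vQ :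
          Set ((logShells X logv Aut Ism hAut hIsm).Packet j vQ)) ⊆ archPk j vQ :=
  fun h => hj ((harch_iff_archPk_eq_univ X logv Aut Ism hAut hIsm archPk).mp h j)

end Real

/-! ## The typed (ii) at the real instantiation with the trivial archimedean integral structure, no hypothesis -/

namespace Real

open Literature.IUT.LogVolume Literature.IUT.LogThetaLattice

variable {F : Type} [Field F] [NumberField F]
variable (X : PilotData F) (Aut Ism : ∀ x : Place F, Set (Carrier x ≃ₗ[ℚ] Carrier x))
  (hAut : ∀ x, LinearEquiv.refl ℚ (Carrier x) ∈ Aut x) (hIsm : ∀ x, LinearEquiv.refl ℚ (Carrier x) ∈ Ism x)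
  (archSub : ∀ (j : (thetaIndex X).Label) (v : Place F),
    Set ((logShells X (analyticLogv F) Aut Ism hAut hIsm).Packet j ((thetaIndex X).over v)))
  (Adm : ∀ (j : (thetaIndex X).Label) (vQ : (thetaIndex X).VQ),
    Set ((logShells X (analyticLogv F) Aut Ism hAut hIsm).Packet j vQ) → Prop)
  (logvol : ∀ (j : (thetaIndex X).Label) (vQ : (thetaIndex X).VQ),
    Set ((logShells X (analyticLogv F) Aut Ism hAut hIsm).Packet j vQ) → ℝ)
  (Ψ : ℤ → ∀ v : Place F, v ∈ (thetaIndex X).Vbad →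
    Set ((logShells X (analyticLogv F) Aut Ism hAut hIsm).StarPacket v))
  (act : ℤ → ∀ v : Place F, v ∈ (thetaIndex X).Vbad →
    (logShells X (analyticLogv F) Aut Ism hAut hIsm).StarPacket v →
      Module.End ℚ ((logShells X (analyticLogv F) Aut Ism hAut hIsm).StarPacket v))
  (Mmod : ℤ → ∀ j : (thetaIndex X).LabelStar,
    Set ((logShells X (analyticLogv F) Aut Ism hAut hIsm).GlobalPacket j.1))
  (region : ℤ → ∀ j : (thetaIndex X).LabelStar, FinDivisor F → ∀ vQ : (thetaIndex X).VQ,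
    Set ((logShells X (analyticLogv F) Aut Ism hAut hIsm).Packet j.1 vQ))
  (thetaDiv₀ : ℤ → ℤ → LgpDivisor F (thetaIndex X).lstar)

/-- **Typed [IUTchIII] Thm. 3.11 (ii) at the real instantiation with `archPk := univ`, NO hypothesis** (analytic
logarithms; = abc-iut-w4-d087's `Real.partII_ofShells_defined` with the trivialisation of the archimedean integral
structure made explicit — by `Real.harch_iff_archPk_eq_univ` this is the ONLY admissible archimedean binder on
this route). [claim: Mochizuki2012, status: disputed] -/
theorem partII_ofShells_archPk_univ :
    (LatticeSituation.ofShells (logShells X (analyticLogv F) Aut Ism hAut hIsm) F (fun _ _ => Set.univ) archSub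
        Adm logvol Ψ act Mmod region (fun _ _ => Adm) (fun _ _ => logvol) (fun n _ => Ψ n) (fun n _ => Mmod n)
        (fun _ _ m' j vQ =>
          (logShells X (analyticLogv F) Aut Ism hAut hIsm).tprodImages j vQ fun v =>
            iterImage (analyticLogv F) m' v.1)
        (fun _ _ j vQ =>
          (logShells X (analyticLogv F) Aut Ism hAut hIsm).tprodImages j vQ fun v =>
            shell (analyticLogv F) v.1)
        thetaDiv₀).PartII :=
  partII_ofShells_honestImages_analyticLogv X Aut Ism hAut hIsm (fun _ _ => Set.univ) archSub Adm logvol Ψ act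
    Mmod region thetaDiv₀
    ((harch_iff_archPk_eq_univ X (analyticLogv F) Aut Ism hAut hIsm (fun _ _ => Set.univ)).mpr fun _ => rfl)

end Real

end Summit.ABC.IUTFork.Thm311

end
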